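import Summits.QuantumFields.BalabanUV.Beta.D1BFx.ReducedKernelPackDiff
import Summits.QuantumFields.BalabanUV.Beta.D1BFx.LamDictionary
import Summits.QuantumFields.BalabanUV.Beta.D1BFx.LamSectorUnfoldGen

/-!
# `BalabanUV.Beta.D1BFx.LamDiffDictionary` — road «BF-x» for binder row D1, slot (K), (S-N) dictionary, (L3) «ΔΛ-ROWS» FILE 2 «ΔΛ-DICT»:
# THE G_Λ DICTIONARY OF THE Λ-DIFFERENCE REST MEMBER — for the Λ-type pack difference `T := c₁ • SdL n Hd` and the Λ₂-type table difference
# `Wf′ := c₂ • WΔ`, the slot-(F) side of `ReducedKernelPackDiff.hF_restΔ_of_divFree` IS `LamWord ν Ndν + LamWord μ Ndμ`, the two instances of the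
# left side of `LamCoeffMoments.blockAvg_M2_lamCoeffOf_eq_zero_of_zeroMomentum` that `LamRowGlue.gLam_row_eq_zero_of_dict` consumes

HONEST DEPENDENCY (page 1, mandatory): continuum YM on T⁴ ⇐ BetaPertH ∧ nine spine estimates (0/9 proved); BetaPertH ⇐ (D1) ∧ (D4) ∧
CAP+tail; G-an2-4 gates asym, D1 and NE2/3/4.  HONEST FRAMING (cell contract, verbatim): «discharging `BetaPertH` makes Bałaban's UV
stability UNCONDITIONAL — a real constructive-QFT result; it is NOT the continuum limit and NOT the Clay problem.»  THIS MODULE DISCHARGES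
NOTHING of the wall: THREE definitions with a body ([our object] the generic-table Λ-pack `SdL n Hd` — `GluonKernelSectors.SbL n = SdL n (hessFF n)`
by `rfl` — and the two PARTNER FUNCTIONALS `Ndν`, `Ndμ` of the difference, the EXACT shapes of `LamDictionary.Nrν`∕`Nrμ` with
`(S_full − cΛ•SbL, Y, TΛ, ωgl·n⁻⁸) ↦ (S, ffOf ∘ Hd, Td, n⁻⁸)` on the ν-side and `(S_full, …) ↦ (S + T, …)` on the μ-side) and [folklore] `tsum`
bookkeeping BY NAME over (L3) FILE 1 `ReducedKernelPackDiff.fineHessΔ_eq_words`, the owner's (L1) `LamSectorUnfoldGen.bubble_SLam_left∕right` ∕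
`tadpole_lamTable_eq_gen`, and my g40 `LamDictionary` §2–§3 plumbing (`summable_lam_mul_of_bdd`, `exists_tadpole_T_bound`, `summable_word_base∕run`,
`word_periodic`, `base_word_eq`, `run_word_eq` — all generic in the partner).  No `Prop` minted, nothing cited, no hypothesis is a printed statement,
0 sorry.  NO letter, NO bound, NO estimate: the Λ₂-slot structure of `WΔ` (`hdecΔ`, `hTloc`, `hWAa`, `hWAl`), the tables' localisation (LH) `hH`, and
the partner functionals' localisation∕covariance letters (`hNdν`, `hNdμ`, `hcovμ` — FILE 3 proves them) are DISPLAYED HYPOTHESES.  0 wall binders;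
(K) NOT closed; NOT D1, NOT `BetaPertH`, NOT continuum, NOT Clay.

ABSOLUTE RULE (cell charter, verbatim): «No internally-minted statement may enter as a cited fact. Every hypothesis is either kernel-proved in
this package or a verbatim quotation of a PUBLISHED theorem with page reference. The manuscript(s) under audit are NOT citable for their own
disputed steps — they are the thing under adjudication; programme-internal (2001/route/tribunal) claims are never citable.»

WHY (memo `OWNER-MEMO-g15.md` §2b «(L3) RE-SIZED HONESTLY» (ii); this lineage's finding F-gan24leaf05-g49-1).  FILE 1 reduced the (1.22) moment of the
ONE rest member `restΔ` to `Σ_b n⁻⁴·fullSum (w ↦ n⁻⁸·w_μ w_ν·baseKer (fineHessΔ … μ ν) b w)`.  When the pack difference is Λ-TYPE — the road's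
Λ-sector shape with the table `hessFF n` replaced by a generic table family `Hd` (the literal-minus-road Λ-table, Q-JC-1′) — and the table difference
carries the Λ₂-slot structure over a companion `Td`, every word of `fineHessΔ` (`biBubbleTable G G S T`, `biBubbleTable G G T (S+T)`, `tadpoleTable Wf′`,
FILE 1 `fineHessΔ_eq_words`) has a Λ′-vertex; unfolding it (the `T ⊗ T` word at its RUNNING vertex — mirror of the road's Λ⊗Λ attribution) gives
the two-word form that `LamRowGlue.gLam_row_eq_zero_of_dict` kills modulo the partners' covariance ∕ decay ∕ zero-momentum letters (FILE 3, FILE 4).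

CONTENT (`Λ′ m y κ u := lamCoeffOf (KInv (N := n) (d := 3)) n m y κ u`, `Y m y := ffOf (Hd m y)`, `G := Ga n a`, `T := c₁ • SdL n Hd`).
* §1 [our object] `SdL`, `SbL_eq_SdL` (`rfl`), **`Ndν`** (partner of a Λ′ at the BASE bond `(ν, b)`: `n⁻⁸·(c₁·½·bubble G (S μ u′) (Y m y) + c₂·½·tadpole G
  (Td m y μ u′))`), **`Ndμ`** (partner of a Λ′ at the RUNNING bond `(μ, ·)`: `n⁻⁸·(c₁·½·bubble G (Y m y) (S ν u′ + c₁ • SdL n Hd ν u′) + c₂·½·tadpole G (Td m y ν u′))`).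
* §2 [folklore] localisation plumbing: `lam_table_common_rate`, `exists_biLoc_SdL`, `exists_bubble_H_bound`.
* §3 [folklore] **`fineHessΔ_lam_pointwise`**: `n⁻⁸·(w_μ·w_ν·baseKer (fineHessΔ n a S T Wf (c₂ • WΔ) μ ν) b w) = w_μ·w_ν·( Σ_m Σ'_y Λ′ m y ν b · Ndν m y (b+w)
  + Σ_m Σ'_y Λ′ m y μ (b+w) · Ndμ m y b )` (`baseKer P b w = P (b+w) b`).
* §4 [folklore] **`lamDiff_row_eq_lamWords`** — THE DICTIONARY: FILE 1's slot-(F) right side EQUALS `LamRowGlue.gLam_row_eq_zero_of_dict`'s `hdict` right side at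
  `(N, d) := (n, 3)`, `(Nrν, Nrμ) := (Ndν … μ, Ndμ … ν)`, token for token.
Unit `b2b-balaban-gan24-formalise-leaf-05` (gen 49), G-an2-4 swarm leaf prover on road «BF-x» (L3); no existing file touched.
-/

noncomputable section

namespace Summit.QuantumFields.BalabanUV.Beta.D1BFx.LamDiffDictionary

open Finset Filter Topology
open scoped BigOperators
open Literature.MathematicalPhysics.QuantumFieldTheory
open Literature.MathematicalPhysics.QuantumFieldTheory.Balaban1983to89
open Literature.MathematicalPhysics.QuantumFieldTheory.Balaban1983to89.Beta
open B12Sec2to5 (l1 l1_nonneg)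
open ExpKernelCalculus (Site MKer Decays BiLoc bubble tadpole Zl)
open DyadicShell (Pt toReal toReal_apply)
open WindowIdentification (fullSum fullSum_eq_tsum_sub)
open DressedMomentNormalisation (resSite)
open AffineAveraging (box toSite)
open OneStepResolventKernel (Fib KInv wsum biLoc_wsum)
open InterLevelTransport (onLat onLat_zsmul SLam)
open BalabanStepJets (lamCoeffOf)
open AveragingHessianKernels (hessFF)
open KernelWard (biLoc_add biLoc_finset_sum)
open StepJetData (biLoc_smul)
open SecondOrderResponse (biLoc_neg)
open KernelReflection (bubble_smul_left bubble_smul_right tadpole_smul)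
open Summit.QuantumFields.BalabanUV.Beta.TameKernelCalculus (Spr Loc trK biLoc_of_le)
open Summit.QuantumFields.BalabanUV.Beta.D1BFx.PackedKernelSplit (bubble_eq_biBubble)
open Summit.QuantumFields.BalabanUV.Beta.D1BFx.FineStencilBF (ffOf)
open Summit.QuantumFields.BalabanUV.Beta.D1BFx.GluonLeg (Ga)
open Summit.QuantumFields.BalabanUV.Beta.D1BFx.ReducedKernel (StencilR TableR)
open Summit.QuantumFields.BalabanUV.Beta.D1BFx.DressedTadpoleTable (Table₂R tadpoleTable_apply)
open Summit.QuantumFields.BalabanUV.Beta.D1BFx.GluonKernelSectors (SbL)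
open Summit.QuantumFields.BalabanUV.Beta.D1BFx.FineHessianSectors (biBubbleTable_apply)
open Summit.QuantumFields.BalabanUV.Beta.D1BFx.MomentTransferPeriodic (baseKer)
open Summit.QuantumFields.BalabanUV.Beta.D1BFx.LamSectorUnfold (exists_abs_lamCoeff_KInv_le abs_onLat_le biLoc_onLat)
open Summit.QuantumFields.BalabanUV.Beta.D1BFx.LamSectorUnfoldGen (ffOf_SLam_eq_neg_sum_wsum bubble_SLam_left bubble_SLam_right tadpole_lamTable_eq_gen)
open Summit.QuantumFields.BalabanUV.Beta.D1BFx.LamDictionary (summable_lam_mul_of_bdd exists_tadpole_T_bound summable_word_base summable_word_run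
  word_periodic base_word_eq run_word_eq)
open Summit.QuantumFields.BalabanUV.Beta.D1BFx.ReducedKernelPackDiff (fineHessΔ fineHessΔ_eq_words)

/-! ## §1 The generic-table Λ-pack and the two partner functionals of the difference -/

section Defs

variable (n : ℕ) [NeZero n] (a : ℝ)

/-- [our object] **THE Λ-TYPE PACK OVER A GENERIC TABLE FAMILY**: `SdL n Hd κ u := ffOf (SLam n Λ′ Hd κ u)` — the road's Λ-sector shape
(`GluonKernelSectors.SbL n`, table `hessFF n`) with the table replaced by `Hd` (the literal-minus-road Λ-table of Q-JC-1′ once named).  A DEFINITION. -/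
def SdL (Hd : Fin 4 → Site 4 → MKer 4 (Fib 3)) : StencilR :=
  fun κ u => ffOf (SLam n (lamCoeffOf (KInv (N := n) (d := 3)) n) Hd κ u)

/-- [our object] Unfolding. -/
theorem SdL_apply (Hd : Fin 4 → Site 4 → MKer 4 (Fib 3)) (κ : Fin 4) (u : Site 4) :
    SdL n Hd κ u = ffOf (SLam n (lamCoeffOf (KInv (N := n) (d := 3)) n) Hd κ u) := rfl

/-- [folklore] CONSISTENCY: the road's Λ-sector IS the instance `Hd := hessFF n` (definitionally). -/
theorem SbL_eq_SdL : SbL n = SdL n (fun m y => hessFF n m y) := rfl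

/-- [our object] **THE PARTNER OF A Λ′ OF THE DIFFERENCE SITTING AT THE BASE BOND `(ν, b)`**: the road-side stencil `S` at the running site against the
table `Y m y = ffOf (Hd m y)` in the fine bubble, plus the companion tadpole; weights `n⁻⁸`, `c₁`, `c₂`, `½` folded in (the shape of `LamDictionary.Nrν`).
A DEFINITION (data); asserts nothing. -/
def Ndν (S : StencilR) (Hd : Fin 4 → Site 4 → MKer 4 (Fib 3)) (Td : Fin 4 → Site 4 → Fin 4 → Site 4 → MKer 4 (Fin 4)) (c₁ c₂ : ℝ)
    (μ : Fin 4) (m : Fin 4) (y u' : Site 4) : ℝ :=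
  ((n : ℝ) ^ 8)⁻¹ * (c₁ * ((1 / 2 : ℝ) * bubble (Ga n a) (S μ u') (ffOf (Hd m y))) + c₂ * ((1 / 2 : ℝ) * tadpole (Ga n a) (Td m y μ u')))

/-- [our object] **THE PARTNER OF A Λ′ OF THE DIFFERENCE SITTING AT THE RUNNING BOND `(μ, ·)`**: the table against the LITERAL's stencil `S + c₁ • SdL n Hd` at
`u′` (the `T ⊗ T` word rides here), plus the companion tadpole (the shape of `LamDictionary.Nrμ`).  A DEFINITION (data); asserts nothing. -/
def Ndμ (S : StencilR) (Hd : Fin 4 → Site 4 → MKer 4 (Fib 3)) (Td : Fin 4 → Site 4 → Fin 4 → Site 4 → MKer 4 (Fin 4)) (c₁ c₂ : ℝ)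
    (ν : Fin 4) (m : Fin 4) (y u' : Site 4) : ℝ :=
  ((n : ℝ) ^ 8)⁻¹ * (c₁ * ((1 / 2 : ℝ) * bubble (Ga n a) (ffOf (Hd m y)) (S ν u' + c₁ • SdL n Hd ν u'))
    + c₂ * ((1 / 2 : ℝ) * tadpole (Ga n a) (Td m y ν u')))

end Defs

/-! ## §2 Localisation plumbing -/

section Loc

variable (n : ℕ) [NeZero n] {a : ℝ} {Hd : Fin 4 → Site 4 → MKer 4 (Fib 3)} {CH δH : ℝ}

/-- [folklore] ONE COMMON RATE for the road's Λ′ ((WΛ) = `exists_abs_lamCoeff_KInv_le`) and a table family localised at its coarse bond ((LH)). -/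
theorem lam_table_common_rate (hδH : 0 < δH) (hH : ∀ (m : Fin 4) (y : Site 4), BiLoc (ffOf (Hd m y)) ((n : ℤ) • y) ((n : ℤ) • y) CH δH) :
    ∃ CΛ δ : ℝ, 0 ≤ CΛ ∧ 0 < δ ∧ δ ≤ δH ∧
      (∀ (m : Fin 4) (y : Site 4) (κ : Fin 4) (u : Site 4),
        |lamCoeffOf (KInv (N := n) (d := 3)) n m y κ u| ≤ CΛ * Real.exp (-δ * l1 ((n : ℤ) • y - u))) ∧
      ∀ (m : Fin 4) (y : Site 4), BiLoc (ffOf (Hd m y)) ((n : ℤ) • y) ((n : ℤ) • y) (|CH|) δ := by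
  obtain ⟨C, δ, hC, hδ, hw⟩ := exists_abs_lamCoeff_KInv_le n
  refine ⟨C, min δ δH, hC, lt_min hδ hδH, min_le_right _ _, fun m y κ u => (hw m y κ u).trans ?_, fun m y => biLoc_of_le (hH m y) (min_le_right _ _)⟩
  exact mul_le_mul_of_nonneg_left (Real.exp_le_exp.2 (by nlinarith [l1_nonneg ((n : ℤ) • y - u), min_le_left δ δH])) hC

/-- [folklore] **THE GENERIC Λ-PACK IS BOND-LOCALISED** (explicit existence): under (LH), `∃ Cl δl > 0, ∀ κ u, BiLoc (SdL n Hd κ u) u u Cl δl`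
(`ffOf_SLam_eq_neg_sum_wsum`, `biLoc_wsum` termwise, finite sum, negation). -/
theorem exists_biLoc_SdL (hδH : 0 < δH) (hH : ∀ (m : Fin 4) (y : Site 4), BiLoc (ffOf (Hd m y)) ((n : ℤ) • y) ((n : ℤ) • y) CH δH) :
    ∃ Cl δl : ℝ, 0 < δl ∧ ∀ (κ : Fin 4) (u : Site 4), BiLoc (SdL n Hd κ u) u u Cl δl := by
  obtain ⟨CΛ, δ, hCΛ, hδ, -, hΛ, hH'⟩ := lam_table_common_rate n hδH hH
  refine ⟨∑ _m : Fin 4, CΛ * |CH| * Zl 4 (δ / 2), δ / 2, half_pos hδ, fun κ u => ?_⟩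
  have hsum : BiLoc (∑ m : Fin 4, wsum (onLat n (fun y => lamCoeffOf (KInv (N := n) (d := 3)) n m y κ u))
      (fun v => onLat n (fun y => ffOf (Hd m y)) v)) u u (∑ _m : Fin 4, CΛ * |CH| * Zl 4 (δ / 2)) (δ / 2) :=
    biLoc_finset_sum _ fun m _ =>
      biLoc_wsum (abs_onLat_le n hCΛ (fun y => hΛ m y κ u)) (biLoc_onLat n (abs_nonneg CH) (hH' m)) hδ hCΛ
  have e : SdL n Hd κ u = fun x z α β => -((∑ m : Fin 4, wsum (onLat n (fun y => lamCoeffOf (KInv (N := n) (d := 3)) n m y κ u))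
      (fun v => onLat n (fun y => ffOf (Hd m y)) v)) x z α β) := by
    rw [SdL_apply, ffOf_SLam_eq_neg_sum_wsum]
    rfl
  rw [e]
  exact biLoc_neg hsum

/-- [folklore] The table bubbles against a bond-localised stencil family are UNIFORMLY BOUNDED in the coarse position (both slot orders) —
`LamDictionary.exists_bubble_Y_bound` with `hessFF n ↦ Hd` under (LH). -/
theorem exists_bubble_H_bound (hGa : Spr (Ga n a)) {S : Fin 4 → Site 4 → MKer 4 (Fin 4)} {Cs δs : ℝ} (hδs : 0 < δs)
    (hS : ∀ κ u, BiLoc (S κ u) u u Cs δs) (hδH : 0 < δH)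
    (hH : ∀ (m : Fin 4) (y : Site 4), BiLoc (ffOf (Hd m y)) ((n : ℤ) • y) ((n : ℤ) • y) CH δH) (m κ : Fin 4) (u : Site 4) :
    ∃ B : ℝ, (∀ y : Site 4, |bubble (Ga n a) (S κ u) (ffOf (Hd m y))| ≤ B) ∧
      ∀ y : Site 4, |bubble (Ga n a) (ffOf (Hd m y)) (S κ u)| ≤ B := by
  have hδm : 0 < min δs δH := lt_min hδs hδH
  have hS' : ∀ v, BiLoc (S κ v) v v (|Cs|) (min δs δH) := fun v => biLoc_of_le (hS κ v) (min_le_left _ _)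
  have hY : ∀ v, BiLoc (onLat n (fun y => ffOf (Hd m y)) v) v v (|CH|) (min δs δH) :=
    biLoc_onLat n (abs_nonneg CH) fun y => biLoc_of_le (hH m y) (min_le_right _ _)
  obtain ⟨B₁, -, h₁⟩ := DressedBubbleBridge.exists_bubble_bound (S := fun v => S κ v) hGa hS' hY hδm
  obtain ⟨B₂, -, h₂⟩ := DressedBubbleBridge.exists_bubble_bound (S' := fun v => S κ v) hGa hY hS' hδm
  refine ⟨max B₁ B₂, fun y => ?_, fun y => ?_⟩
  · have h := h₁ u ((n : ℤ) • y)
    rw [onLat_zsmul] at h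
    exact h.trans (le_max_left _ _)
  · have h := h₂ ((n : ℤ) • y) u
    rw [onLat_zsmul] at h
    exact h.trans (le_max_right _ _)

end Loc

/-! ## §3 The pointwise identity -/

section Pointwise

variable (n : ℕ) [NeZero n] (a : ℝ) {S : StencilR} {Cs δs : ℝ} {Hd : Fin 4 → Site 4 → MKer 4 (Fib 3)} {CH δH : ℝ}
  {Wf WΔ : Table₂R} {CΔ δΔ : ℝ} {Td WAd : Fin 4 → Site 4 → Fin 4 → Site 4 → MKer 4 (Fin 4)} {CT δT : ℝ}

/-- [folklore] **THE POINTWISE IDENTITY** (FILE 1 `fineHessΔ_eq_words` + (L1) unfoldings assembled): at a base site `b` and displacement `w`, for `0 < a`,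
`Spr (Ga n a)`, `S` bond-localised, the tables (LH), the road table `Wf` localised, `WΔ` bi-localised and carrying the DISPLAYED Λ₂ structure (`hdecΔ`,
`hTloc`, `hWAa`, `hWAl`):
`n⁻⁸·(w_μ·w_ν·baseKer (fineHessΔ n a S (c₁ • SdL n Hd) Wf (c₂ • WΔ) μ ν) b w) = w_μ·w_ν·( Σ_m Σ'_y Λ′ m y ν b · Ndν m y (b+w) + Σ_m Σ'_y Λ′ m y μ (b+w) · Ndμ m y b )`. -/
theorem fineHessΔ_lam_pointwise (ha : 0 < a) (hGa : Spr (Ga n a)) (hδs : 0 < δs) (hS : ∀ κ u, BiLoc (S κ u) u u Cs δs)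
    (hδH : 0 < δH) (hH : ∀ (m : Fin 4) (y : Site 4), BiLoc (ffOf (Hd m y)) ((n : ℤ) • y) ((n : ℤ) • y) CH δH)
    (hW : ∀ κ u l u', Loc (Wf κ u l u')) (hδΔ : 0 < δΔ) (hΔ : ∀ κ u l u', BiLoc (WΔ κ u l u') u u' CΔ δΔ) (hδT : 0 < δT)
    (hdecΔ : ∀ κ u l u', WΔ κ u l u' =
      (∑ m : Fin 4, wsum (onLat n (fun y => lamCoeffOf (KInv (N := n) (d := 3)) n m y l u')) (fun v => onLat n (fun y => Td m y κ u) v))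
      + (∑ m : Fin 4, wsum (onLat n (fun y => lamCoeffOf (KInv (N := n) (d := 3)) n m y κ u)) (fun v => onLat n (fun y => Td m y l u') v))
      + WAd κ u l u')
    (hTloc : ∀ m y κ u, BiLoc (Td m y κ u) ((n : ℤ) • y) ((n : ℤ) • y) (CT * Real.exp (-δT * l1 ((n : ℤ) • y - u))) δT)
    (hWAa : ∀ κ u l u', trK (WAd κ u l u') = -WAd κ u l u') (hWAl : ∀ κ u l u', Loc (WAd κ u l u'))
    (c₁ c₂ : ℝ) (μ ν : Fin 4) (b w : Pt) :
    ((n : ℝ) ^ 8)⁻¹ * (toReal w μ * toReal w ν *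
        baseKer (fineHessΔ n a S (fun κ u => c₁ • SdL n Hd κ u) Wf (fun κ u l u' => c₂ • WΔ κ u l u') μ ν) b w)
      = toReal w μ * toReal w ν *
        ((∑ m : Fin 4, ∑' y : Site 4, lamCoeffOf (KInv (N := n) (d := 3)) n m y ν b * Ndν n a S Hd Td c₁ c₂ μ m y (b + w))
        + ∑ m : Fin 4, ∑' y : Site 4, lamCoeffOf (KInv (N := n) (d := 3)) n m y μ (b + w) * Ndμ n a S Hd Td c₁ c₂ ν m y b) := by
  -- common rate for Λ′ and the tables; localisation of the Λ-pack
  obtain ⟨CΛ, δ₀, hCΛ, hδ₀, -, hΛ₀, hH₀⟩ := lam_table_common_rate n hδH hH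
  obtain ⟨Cl, δl, hδl, hSl⟩ := exists_biLoc_SdL n hδH hH
  -- `S` and `T := c₁ • SdL` at one rate for FILE 1's word census
  have hδ₁ : 0 < min δs δl := lt_min hδs hδl
  have hS₁ : ∀ (κ : Fin 4) (u : Site 4), BiLoc (S κ u) u u (|Cs|) (min δs δl) := fun κ u => biLoc_of_le (hS κ u) (min_le_left _ _)
  have hT₁ : ∀ (κ : Fin 4) (u : Site 4), BiLoc ((fun κ u => c₁ • SdL n Hd κ u) κ u) u u (|c₁| * |Cl|) (min δs δl) :=
    fun κ u => biLoc_smul (biLoc_of_le (hSl κ u) (min_le_right _ _)) c₁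
  have hST : ∀ (κ : Fin 4) (u : Site 4), BiLoc (S κ u + c₁ • SdL n Hd κ u) u u (|Cs| + |c₁| * |Cl|) (min δs δl) :=
    fun κ u => biLoc_add (hS₁ κ u) (hT₁ κ u)
  have hW' : ∀ κ u l u', Loc ((fun κ u l u' => c₂ • WΔ κ u l u') κ u l u') := fun κ u l u' => Loc.smul c₂ ⟨u, u', CΔ, δΔ, hδΔ, hΔ κ u l u'⟩
  have hLS : Loc (S μ (b + w)) := ⟨b + w, b + w, Cs, δs, hδs, hS μ (b + w)⟩
  have hLST : Loc (S ν b + c₁ • SdL n Hd ν b) := ⟨b, b, _, _, hδ₁, hST ν b⟩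
  -- FILE 1's census at `(b + w, b)`, then (L1) in each of the three words
  rw [baseKer, fineHessΔ_eq_words n a hGa hS₁ hT₁ hδ₁ hW hW' μ ν (b + w) b, biBubbleTable_apply, biBubbleTable_apply,
    ← bubble_eq_biBubble, ← bubble_eq_biBubble, tadpoleTable_apply]
  have hR : bubble (Ga n a) (S μ (b + w)) (SdL n Hd ν b)
      = -∑ m : Fin 4, ∑' y : Site 4, lamCoeffOf (KInv (N := n) (d := 3)) n m y ν b * bubble (Ga n a) (S μ (b + w)) (ffOf (Hd m y)) :=
    bubble_SLam_right n hGa hCΛ hδ₀ hΛ₀ hH₀ hLS ν b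
  have hL : bubble (Ga n a) (SdL n Hd μ (b + w)) (S ν b + c₁ • SdL n Hd ν b)
      = -∑ m : Fin 4, ∑' y : Site 4, lamCoeffOf (KInv (N := n) (d := 3)) n m y μ (b + w) * bubble (Ga n a) (ffOf (Hd m y)) (S ν b + c₁ • SdL n Hd ν b) :=
    bubble_SLam_left n hGa hCΛ hδ₀ hΛ₀ hH₀ hLST μ (b + w)
  rw [bubble_smul_right, bubble_smul_left, tadpole_smul, hR, hL,
    tadpole_lamTable_eq_gen n ha hGa hCΛ hδ₀ hΛ₀ hδT hdecΔ hTloc hWAa hWAl μ (b + w) ν b]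
  -- the four coarse families are bounded, hence summable against Λ′; fold each partner functional
  have eν : ∀ m : Fin 4,
      (∑' y : Site 4, lamCoeffOf (KInv (N := n) (d := 3)) n m y ν b * Ndν n a S Hd Td c₁ c₂ μ m y (b + w))
        = ((n : ℝ) ^ 8)⁻¹ * (c₁ * (1 / 2 : ℝ)) *
            (∑' y : Site 4, lamCoeffOf (KInv (N := n) (d := 3)) n m y ν b * bubble (Ga n a) (S μ (b + w)) (ffOf (Hd m y)))
          + ((n : ℝ) ^ 8)⁻¹ * (c₂ * (1 / 2 : ℝ)) *
            (∑' y : Site 4, lamCoeffOf (KInv (N := n) (d := 3)) n m y ν b * tadpole (Ga n a) (Td m y μ (b + w))) := by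
    intro m
    obtain ⟨B₂, hB₂, -⟩ := exists_bubble_H_bound n hGa hδs hS hδH hH m μ (b + w)
    obtain ⟨BT, hBT⟩ := exists_tadpole_T_bound n hGa hδT hTloc m μ (b + w)
    rw [← tsum_mul_left, ← tsum_mul_left, ← ((summable_lam_mul_of_bdd n hB₂ m ν b).mul_left _).tsum_add
      ((summable_lam_mul_of_bdd n hBT m ν b).mul_left _)]
    exact tsum_congr fun y => by simp only [Ndν]; ring
  have eμ : ∀ m : Fin 4,
      (∑' y : Site 4, lamCoeffOf (KInv (N := n) (d := 3)) n m y μ (b + w) * Ndμ n a S Hd Td c₁ c₂ ν m y b)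
        = ((n : ℝ) ^ 8)⁻¹ * (c₁ * (1 / 2 : ℝ)) *
            (∑' y : Site 4, lamCoeffOf (KInv (N := n) (d := 3)) n m y μ (b + w) *
              bubble (Ga n a) (ffOf (Hd m y)) (S ν b + c₁ • SdL n Hd ν b))
          + ((n : ℝ) ^ 8)⁻¹ * (c₂ * (1 / 2 : ℝ)) *
            (∑' y : Site 4, lamCoeffOf (KInv (N := n) (d := 3)) n m y μ (b + w) * tadpole (Ga n a) (Td m y ν b)) := by
    intro m
    obtain ⟨B₁, -, hB₁⟩ := exists_bubble_H_bound n hGa hδ₁ (S := fun κ u => S κ u + c₁ • SdL n Hd κ u) hST hδH hH m ν b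
    obtain ⟨BT, hBT⟩ := exists_tadpole_T_bound n hGa hδT hTloc m ν b
    rw [← tsum_mul_left, ← tsum_mul_left, ← ((summable_lam_mul_of_bdd n hB₁ m μ (b + w)).mul_left _).tsum_add
      ((summable_lam_mul_of_bdd n hBT m μ (b + w)).mul_left _)]
    exact tsum_congr fun y => by simp only [Ndμ]; ring
  simp only [eν, eμ, Finset.sum_add_distrib, ← Finset.mul_sum]
  ring

end Pointwise

/-! ## §4 THE DICTIONARY -/

section Assembly

variable (n : ℕ) [NeZero n] (a : ℝ) {S : StencilR} {Cs δs : ℝ} {Hd : Fin 4 → Site 4 → MKer 4 (Fib 3)} {CH δH : ℝ}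
  {Wf WΔ : Table₂R} {CΔ δΔ : ℝ} {Td WAd : Fin 4 → Site 4 → Fin 4 → Site 4 → MKer 4 (Fin 4)} {CT δT : ℝ} (μ ν : Fin 4)

/-- [folklore] **THE Λ-DICTIONARY OF THE DIFFERENCE REST MEMBER.**  For the data of FILE 1 at one block size `n` with a Λ-TYPE pack difference
`T := c₁ • SdL n Hd` and table difference `Wf′ := c₂ • WΔ` — `0 < a`, `Spr (Ga n a)`, `S` bond-localised, (LH) for `Hd`, `Wf` localised, `WΔ` bi-localised
with the DISPLAYED Λ₂ structure (`hdecΔ`, `hTloc`, `hWAa`, `hWAl`), and the partner functionals' DISPLAYED letters (localisation `hNdν`∕`hNdμ`, block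
covariance `hcovμ`; FILE 3): the slot-(F) right side of `ReducedKernelPackDiff.hF_restΔ_of_divFree` —
`Σ_{b ∈ univ.image resSite} n⁻⁴·fullSum (w ↦ n⁻⁸·(w_μ·w_ν·baseKer (fineHessΔ … μ ν) b w))` — EQUALS
`n⁻⁴·Σ_{b ∈ box 4 n} Σ'_{u′} (u′−b)_μ (u′−b)_ν · Σ_m Σ'_y Λ′ m y ν (toSite b)·Ndν m y u′ + n⁻⁴·Σ_{b ∈ box 4 n} Σ'_{u′} (u′−b)_μ (u′−b)_ν · Σ_m Σ'_y Λ′ m y μ (toSite b)·Ndμ m y u′`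
— `LamRowGlue.gLam_row_eq_zero_of_dict`'s `hdict` right side at `(N, d) := (n, 3)`.  Steps: §3 pointwise, `fullSum → tsum` (the integrand vanishes at
`w = 0`), `LamDictionary.base_word_eq` for the base word, `run_word_eq` ((S-TRANSP) under `hcovμ`) for the running word. -/
theorem lamDiff_row_eq_lamWords (ha : 0 < a) (hGa : Spr (Ga n a)) (hδs : 0 < δs) (hS : ∀ κ u, BiLoc (S κ u) u u Cs δs)
    (hδH : 0 < δH) (hH : ∀ (m : Fin 4) (y : Site 4), BiLoc (ffOf (Hd m y)) ((n : ℤ) • y) ((n : ℤ) • y) CH δH)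
    (hW : ∀ κ u l u', Loc (Wf κ u l u')) (hδΔ : 0 < δΔ) (hΔ : ∀ κ u l u', BiLoc (WΔ κ u l u') u u' CΔ δΔ) (hδT : 0 < δT)
    (hdecΔ : ∀ κ u l u', WΔ κ u l u' =
      (∑ m : Fin 4, wsum (onLat n (fun y => lamCoeffOf (KInv (N := n) (d := 3)) n m y l u')) (fun v => onLat n (fun y => Td m y κ u) v))
      + (∑ m : Fin 4, wsum (onLat n (fun y => lamCoeffOf (KInv (N := n) (d := 3)) n m y κ u)) (fun v => onLat n (fun y => Td m y l u') v))
      + WAd κ u l u')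
    (hTloc : ∀ m y κ u, BiLoc (Td m y κ u) ((n : ℤ) • y) ((n : ℤ) • y) (CT * Real.exp (-δT * l1 ((n : ℤ) • y - u))) δT)
    (hWAa : ∀ κ u l u', trK (WAd κ u l u') = -WAd κ u l u') (hWAl : ∀ κ u l u', Loc (WAd κ u l u'))
    (c₁ c₂ : ℝ) {Cν δν Cμ δμ : ℝ} (hδν : 0 < δν) (hδμ : 0 < δμ)
    (hNdν : ∀ m y u, |Ndν n a S Hd Td c₁ c₂ μ m y u| ≤ Cν * Real.exp (-δν * l1 ((n : ℤ) • y - u)))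
    (hNdμ : ∀ m y u, |Ndμ n a S Hd Td c₁ c₂ ν m y u| ≤ Cμ * Real.exp (-δμ * l1 ((n : ℤ) • y - u)))
    (hcovμ : ∀ m y t u', Ndμ n a S Hd Td c₁ c₂ ν m (y + t) (u' + (n : ℤ) • t) = Ndμ n a S Hd Td c₁ c₂ ν m y u') :
    ∑ b ∈ (univ : Finset (Fin 4 → Fin n)).image resSite, ((n : ℝ) ^ 4)⁻¹ *
        fullSum (fun w : Pt => ((n : ℝ) ^ 8)⁻¹ * (toReal w μ * toReal w ν *
          baseKer (fineHessΔ n a S (fun κ u => c₁ • SdL n Hd κ u) Wf (fun κ u l u' => c₂ • WΔ κ u l u') μ ν) b w))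
      = ((n : ℝ) ^ (3 + 1))⁻¹ * ∑ b ∈ box (3 + 1) n, ∑' u', ((((u' - toSite b) μ : ℤ) : ℝ) * (((u' - toSite b) ν : ℤ) : ℝ))
            * (∑ m, ∑' y, lamCoeffOf (KInv (N := n) (d := 3)) n m y ν (toSite b) * Ndν n a S Hd Td c₁ c₂ μ m y u')
        + ((n : ℝ) ^ (3 + 1))⁻¹ * ∑ b ∈ box (3 + 1) n, ∑' u', ((((u' - toSite b) μ : ℤ) : ℝ) * (((u' - toSite b) ν : ℤ) : ℝ))
            * (∑ m, ∑' y, lamCoeffOf (KInv (N := n) (d := 3)) n m y μ (toSite b) * Ndμ n a S Hd Td c₁ c₂ ν m y u') := by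
  -- the two words at a base site, as functions of the displacement
  have hSν := fun b : Pt => summable_word_base n μ ν hδν hNdν ν b
  have hSμ := fun b : Pt => summable_word_run n μ ν hδμ hNdμ μ b
  -- per base site: the full lattice sum of the integrand is the sum of the two words' lattice sums
  have hbase : ∀ b : Pt,
      fullSum (fun w : Pt => ((n : ℝ) ^ 8)⁻¹ * (toReal w μ * toReal w ν *
          baseKer (fineHessΔ n a S (fun κ u => c₁ • SdL n Hd κ u) Wf (fun κ u l u' => c₂ • WΔ κ u l u') μ ν) b w))
        = (∑' w : Pt, ((w μ : ℤ) : ℝ) * ((w ν : ℤ) : ℝ) *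
            ∑ m : Fin 4, ∑' y : Site 4, lamCoeffOf (KInv (N := n) (d := 3)) n m y ν b * Ndν n a S Hd Td c₁ c₂ μ m y (b + w))
          + ∑' w : Pt, ((w μ : ℤ) : ℝ) * ((w ν : ℤ) : ℝ) *
            ∑ m : Fin 4, ∑' y : Site 4, lamCoeffOf (KInv (N := n) (d := 3)) n m y μ (b + w) * Ndμ n a S Hd Td c₁ c₂ ν m y b := by
    intro b
    have e : (fun w : Pt => ((n : ℝ) ^ 8)⁻¹ * (toReal w μ * toReal w ν *
          baseKer (fineHessΔ n a S (fun κ u => c₁ • SdL n Hd κ u) Wf (fun κ u l u' => c₂ • WΔ κ u l u') μ ν) b w))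
        = fun w : Pt => ((w μ : ℤ) : ℝ) * ((w ν : ℤ) : ℝ) *
            (∑ m : Fin 4, ∑' y : Site 4, lamCoeffOf (KInv (N := n) (d := 3)) n m y ν b * Ndν n a S Hd Td c₁ c₂ μ m y (b + w))
          + ((w μ : ℤ) : ℝ) * ((w ν : ℤ) : ℝ) *
            ∑ m : Fin 4, ∑' y : Site 4, lamCoeffOf (KInv (N := n) (d := 3)) n m y μ (b + w) * Ndμ n a S Hd Td c₁ c₂ ν m y b := by
      funext w
      rw [fineHessΔ_lam_pointwise n a ha hGa hδs hS hδH hH hW hδΔ hΔ hδT hdecΔ hTloc hWAa hWAl c₁ c₂ μ ν b w, toReal_apply, toReal_apply,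
        mul_add]
    rw [e, fullSum_eq_tsum_sub _ ((hSν b).add (hSμ b)), (hSν b).tsum_add (hSμ b)]
    simp only [Pi.zero_apply, Int.cast_zero, zero_mul, add_zero, sub_zero]
  rw [sum_congr rfl fun b _ => by rw [hbase b]]
  simp only [mul_add, sum_add_distrib]
  show _ = ((n : ℝ) ^ 4)⁻¹ * (∑ b ∈ box 4 n, _) + ((n : ℝ) ^ 4)⁻¹ * (∑ b ∈ box 4 n, _)
  congr 1
  · exact base_word_eq n μ ν _ (fun u v => ∑ m : Fin 4, ∑' y : Site 4,
      lamCoeffOf (KInv (N := n) (d := 3)) n m y ν u * Ndν n a S Hd Td c₁ c₂ μ m y v)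
  · exact run_word_eq n μ ν _ (fun u v => ∑ m : Fin 4, ∑' y : Site 4,
      lamCoeffOf (KInv (N := n) (d := 3)) n m y μ u * Ndμ n a S Hd Td c₁ c₂ ν m y v)
      (fun u v t => word_periodic n hcovμ μ u v t) (fun r => hSμ (resSite r)) (fun r => summable_word_base n μ ν hδμ hNdμ μ (resSite r))

end Assembly

end Summit.QuantumFields.BalabanUV.Beta.D1BFx.LamDiffDictionary

end
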